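import Summits.AtomisticToContinuum.HydrodynamicLimit.Theorems.LambertianContactSwapLambertianWellPosedPhaseLift

/-!
# The Lambertian pre-kick of a pair preserves vol ⊗ γ on the good pair data

Helper file (`--supports`) of the support item `LambertianWellPosed` of route `LambertianContactSwap`
(`AtomisticToContinuum/HydrodynamicLimit`, stmt-AtomisticToContinuum-12101); part of the chain
HalfAngle → FluxLaw → Cylinder → PhaseLift → JInv proving that the Lambertian pre-kick of a pair preserves
`vol ⊗ γ` on the good pair data (the cosine law of the redraw). See the docstrings of the declarations.
-/

noncomputable section

open MeasureTheory ProbabilityTheory Set Function Filter Metric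
open scoped ENNReal InnerProductSpace Real

namespace Summit.AtomisticToContinuum.HydrodynamicLimit.Theorems

open Literature.MathematicalPhysics.KineticTheory Literature.Analysis.FluidPDE
  Literature.Analysis.FluidPDE.Alexander

open LWindow

namespace HalfAngle

/-! ## The Lambertian pre-kick `J` of a pair on the torus -/

section JMap

variable {d : Type*} [Fintype d] {N : ℕ} {i j : Fin N} {ε : ℝ}

/-- **The Lambertian pre-kick in relative coordinates** (`Φ = shearAt i (z ↦ −z_j)`, particle `i`
relative to particle `j`): `Φ ∘ J_ξ` is "redraw coordinate `i` by the chart redraw of its relative data,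
then translate coordinate `j` by the half-impulse", applied to `Φ z` (chart condition on the pair).
[folklore] -/
theorem shearAt_lambertKick (hij : i ≠ j) (z : Config N d (UnitAddTorus d)) (ξ : EuclideanSpace ℝ d)
    (hch : ‖(Torus.geometry d).sepVec (z i).1 (z j).1‖ +
      |pairHitTime ε ((Torus.geometry d).sepVec (z i).1 (z j).1) ((z i).2 - (z j).2)| * ‖(z i).2 - (z j).2‖ < 1 / 2) :
    shearAt i (fun z => -z j) (freeFlight (Torus.geometry d)
        (-pairHitTime ε ((Torus.geometry d).sepVec (z i).1 (z j).1) ((z i).2 - (z j).2))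
        (collidePair (Torus.geometry d) i j (lambertPair (Torus.geometry d) i j
          (freeFlight (Torus.geometry d)
            (pairHitTime ε ((Torus.geometry d).sepVec (z i).1 (z j).1) ((z i).2 - (z j).2)) z) ξ))) =
      update (update (shearAt i (fun z => -z j) z) i
        (projPhase (hitPoint ε (liftPhase (shearAt i (fun z => -z j) z i)) -
            pairHitTime ε (liftPhase (shearAt i (fun z => -z j) z i)).1 (liftPhase (shearAt i (fun z => -z j) z i)).2 •
              (‖(liftPhase (shearAt i (fun z => -z j) z i)).2‖ •
                (lambertDir (hitPoint ε (liftPhase (shearAt i (fun z => -z j) z i))) ξ - (2 * ⟪lambertDir (hitPoint ε (liftPhase (shearAt i (fun z => -z j) z i))) ξ, hitPoint ε (liftPhase (shearAt i (fun z => -z j) z i))⟫_ℝ / ‖hitPoint ε (liftPhase (shearAt i (fun z => -z j) z i))‖ ^ 2) • hitPoint ε (liftPhase (shearAt i (fun z => -z j) z i)))),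
          ‖(liftPhase (shearAt i (fun z => -z j) z i)).2‖ •
            (lambertDir (hitPoint ε (liftPhase (shearAt i (fun z => -z j) z i))) ξ - (2 * ⟪lambertDir (hitPoint ε (liftPhase (shearAt i (fun z => -z j) z i))) ξ, hitPoint ε (liftPhase (shearAt i (fun z => -z j) z i))⟫_ℝ / ‖hitPoint ε (liftPhase (shearAt i (fun z => -z j) z i))‖ ^ 2) • hitPoint ε (liftPhase (shearAt i (fun z => -z j) z i))))))
        j (shearAt i (fun z => -z j) z j +
          (Literature.Analysis.FunctionSpaces.Torus.proj
            (-(pairHitTime ε (liftPhase (shearAt i (fun z => -z j) z i)).1 (liftPhase (shearAt i (fun z => -z j) z i)).2 •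
              ((2 : ℝ)⁻¹ • ((liftPhase (shearAt i (fun z => -z j) z i)).2 -
                ‖(liftPhase (shearAt i (fun z => -z j) z i)).2‖ •
                  (lambertDir (hitPoint ε (liftPhase (shearAt i (fun z => -z j) z i))) ξ - (2 * ⟪lambertDir (hitPoint ε (liftPhase (shearAt i (fun z => -z j) z i))) ξ, hitPoint ε (liftPhase (shearAt i (fun z => -z j) z i))⟫_ℝ / ‖hitPoint ε (liftPhase (shearAt i (fun z => -z j) z i))‖ ^ 2) • hitPoint ε (liftPhase (shearAt i (fun z => -z j) z i))))))),
           (2 : ℝ)⁻¹ • ((liftPhase (shearAt i (fun z => -z j) z i)).2 -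
              ‖(liftPhase (shearAt i (fun z => -z j) z i)).2‖ •
                (lambertDir (hitPoint ε (liftPhase (shearAt i (fun z => -z j) z i))) ξ - (2 * ⟪lambertDir (hitPoint ε (liftPhase (shearAt i (fun z => -z j) z i))) ξ, hitPoint ε (liftPhase (shearAt i (fun z => -z j) z i))⟫_ℝ / ‖hitPoint ε (liftPhase (shearAt i (fun z => -z j) z i))‖ ^ 2) • hitPoint ε (liftPhase (shearAt i (fun z => -z j) z i)))))) := by
  have hΞi : shearAt i (fun z => -z j) z i = z i - z j := by rw [shearAt_apply_self, ← sub_eq_add_neg]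
  have hΞj : shearAt i (fun z => -z j) z j = z j := shearAt_apply_of_ne hij.symm z
  have hlift : liftPhase (z i - z j) = ((Torus.geometry d).sepVec (z i).1 (z j).1, (z i).2 - (z j).2) := rfl
  rw [hΞi, hΞj, hlift]
  dsimp only
  obtain ⟨Hi, Hj⟩ := lambertKick_apply_pair hij z ξ hch
  set τ₀ := pairHitTime ε ((Torus.geometry d).sepVec (z i).1 (z j).1) ((z i).2 - (z j).2) with hτ₀
  set n := hitPoint ε ((Torus.geometry d).sepVec (z i).1 (z j).1, (z i).2 - (z j).2) with hn
  set b := (2 : ℝ)⁻¹ • (((z i).2 - (z j).2) - ‖(z i).2 - (z j).2‖ • (lambertDir n ξ - (2 * ⟪lambertDir n ξ, n⟫_ℝ / ‖n‖ ^ 2) • n)) with hb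
  set u' := ‖(z i).2 - (z j).2‖ • (lambertDir n ξ - (2 * ⟪lambertDir n ξ, n⟫_ℝ / ‖n‖ ^ 2) • n) with hu'
  set J := freeFlight (Torus.geometry d) (-τ₀) (collidePair (Torus.geometry d) i j
    (lambertPair (Torus.geometry d) i j (freeFlight (Torus.geometry d) τ₀ z) ξ)) with hJ
  have hb2 : (z i).2 - (z j).2 - u' = (2 : ℝ) • b := by
    rw [hb, smul_smul, mul_inv_cancel₀ two_ne_zero, one_smul]
  have hnq : n = (Torus.geometry d).sepVec (z i).1 (z j).1 + τ₀ • ((z i).2 - (z j).2) := rfl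
  funext k
  by_cases hki : k = i
  · subst hki
    rw [update_of_ne hij, update_self, shearAt_apply_self, Hi, Hj, projPhase]
    refine Prod.ext ?_ ?_
    · dsimp only
      have e : (Torus.geometry d).sepVec (z k).1 (z j).1 + τ₀ • ((z k).2 - (z j).2) - τ₀ • u' =
          (Torus.geometry d).sepVec (z k).1 (z j).1 + (τ₀ • b + τ₀ • b) := by
        rw [← smul_add, ← two_smul ℝ b, ← hb2, smul_sub]; module
      rw [hnq, e, Literature.Analysis.FunctionSpaces.Torus.proj_add, Literature.Analysis.FunctionSpaces.Torus.proj_add,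
        Torus.geometry_sepVec, Torus.proj_reprSym]
      simp only [Prod.fst_add, Prod.fst_neg]
      abel
    · dsimp only
      simp only [Prod.snd_add, Prod.snd_neg]
      have : (z k).2 - b + -((z j).2 + b) = (z k).2 - (z j).2 - (2 : ℝ) • b := by rw [two_smul]; abel
      rw [this, ← hb2, sub_sub_cancel]
  · by_cases hkj : k = j
    · subst hkj
      rw [update_self, shearAt_apply_of_ne hki, Hj]
      refine Prod.ext ?_ ?_
      · simp only [Prod.fst_add, Literature.Analysis.FunctionSpaces.Torus.proj_neg, sub_eq_add_neg]
      · simp only [Prod.snd_add]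
    · rw [update_of_ne hkj, update_of_ne hki, shearAt_apply_of_ne hki, shearAt_apply_of_ne hki, hJ,
        lambertKick_apply_of_ne hki hkj]

/-- The chart redraw of the relative data is jointly measurable in (datum, noise). [folklore] -/
theorem measurable_redrawRel (ε : ℝ) :
    Measurable fun p : (EuclideanSpace ℝ (Fin 3) × EuclideanSpace ℝ (Fin 3)) × EuclideanSpace ℝ (Fin 3) =>
      (hitPoint ε p.1 - pairHitTime ε p.1.1 p.1.2 •
          (‖p.1.2‖ • (lambertDir (hitPoint ε p.1) p.2 - (2 * ⟪lambertDir (hitPoint ε p.1) p.2, hitPoint ε p.1⟫_ℝ / ‖hitPoint ε p.1‖ ^ 2) • hitPoint ε p.1)),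
        ‖p.1.2‖ • (lambertDir (hitPoint ε p.1) p.2 - (2 * ⟪lambertDir (hitPoint ε p.1) p.2, hitPoint ε p.1⟫_ℝ / ‖hitPoint ε p.1‖ ^ 2) • hitPoint ε p.1)) := by
  have hn : Measurable fun p : (EuclideanSpace ℝ (Fin 3) × EuclideanSpace ℝ (Fin 3)) ×
      EuclideanSpace ℝ (Fin 3) => hitPoint ε p.1 := (measurable_hitPoint ε).comp measurable_fst
  have hτ : Measurable fun p : (EuclideanSpace ℝ (Fin 3) × EuclideanSpace ℝ (Fin 3)) ×
      EuclideanSpace ℝ (Fin 3) => pairHitTime ε p.1.1 p.1.2 := (measurable_pairHitTime ε).comp measurable_fst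
  have hd : Measurable fun p : (EuclideanSpace ℝ (Fin 3) × EuclideanSpace ℝ (Fin 3)) ×
      EuclideanSpace ℝ (Fin 3) => lambertDir (hitPoint ε p.1) p.2 := hn.lambertDir measurable_snd
  have hu : Measurable fun p : (EuclideanSpace ℝ (Fin 3) × EuclideanSpace ℝ (Fin 3)) ×
      EuclideanSpace ℝ (Fin 3) => ‖p.1.2‖ • (lambertDir (hitPoint ε p.1) p.2 -
        (2 * ⟪lambertDir (hitPoint ε p.1) p.2, hitPoint ε p.1⟫_ℝ / ‖hitPoint ε p.1‖ ^ 2) • hitPoint ε p.1) :=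
    (measurable_snd.comp measurable_fst).norm.smul (hd.sub (((measurable_const.mul (hd.inner hn)).div
      (hn.norm.pow_const 2)).smul hn))
  exact (hn.sub (hτ.smul hu)).prodMk hu

/-- The half-impulse of the redraw is jointly measurable in (datum, noise). [folklore] -/
theorem measurable_halfImpulse (ε : ℝ) :
    Measurable fun p : (EuclideanSpace ℝ (Fin 3) × EuclideanSpace ℝ (Fin 3)) × EuclideanSpace ℝ (Fin 3) =>
      (2 : ℝ)⁻¹ • (p.1.2 - ‖p.1.2‖ • (lambertDir (hitPoint ε p.1) p.2 - (2 * ⟪lambertDir (hitPoint ε p.1) p.2, hitPoint ε p.1⟫_ℝ / ‖hitPoint ε p.1‖ ^ 2) • hitPoint ε p.1)) := by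
  have h1 : Measurable fun p : (EuclideanSpace ℝ (Fin 3) × EuclideanSpace ℝ (Fin 3)) × EuclideanSpace ℝ (Fin 3) =>
      p.1.2 := measurable_snd.comp measurable_fst
  have h2 : Measurable fun p : (EuclideanSpace ℝ (Fin 3) × EuclideanSpace ℝ (Fin 3)) × EuclideanSpace ℝ (Fin 3) =>
      ‖p.1.2‖ • (lambertDir (hitPoint ε p.1) p.2 - (2 * ⟪lambertDir (hitPoint ε p.1) p.2, hitPoint ε p.1⟫_ℝ / ‖hitPoint ε p.1‖ ^ 2) • hitPoint ε p.1) :=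
    measurable_snd.comp (measurable_redrawRel ε)
  exact (h1.sub h2).const_smul ((2 : ℝ)⁻¹)

/-- The Lambertian pre-kick of a pair is jointly measurable in (datum, noise). [folklore] -/
theorem measurable_lambertKick (ε : ℝ) (i j : Fin N) :
    Measurable fun p : Config N (Fin 3) (UnitAddTorus (Fin 3)) × EuclideanSpace ℝ (Fin 3) =>
      freeFlight (Torus.geometry (Fin 3))
        (-pairHitTime ε ((Torus.geometry (Fin 3)).sepVec (p.1 i).1 (p.1 j).1) ((p.1 i).2 - (p.1 j).2))
        (collidePair (Torus.geometry (Fin 3)) i j (lambertPair (Torus.geometry (Fin 3)) i j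
          (freeFlight (Torus.geometry (Fin 3))
            (pairHitTime ε ((Torus.geometry (Fin 3)).sepVec (p.1 i).1 (p.1 j).1) ((p.1 i).2 - (p.1 j).2)) p.1) p.2)) := by
  have hGm : (Torus.geometry (Fin 3)).IsMeasurable := Torus.isMeasurable_geometry
  have hτ : Measurable fun p : Config N (Fin 3) (UnitAddTorus (Fin 3)) × EuclideanSpace ℝ (Fin 3) =>
      pairHitTime ε ((Torus.geometry (Fin 3)).sepVec (p.1 i).1 (p.1 j).1) ((p.1 i).2 - (p.1 j).2) :=
    (measurable_pairHitTime_config ε i j).comp measurable_fst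
  have hS : Measurable fun p : Config N (Fin 3) (UnitAddTorus (Fin 3)) × EuclideanSpace ℝ (Fin 3) =>
      freeFlight (Torus.geometry (Fin 3))
        (pairHitTime ε ((Torus.geometry (Fin 3)).sepVec (p.1 i).1 (p.1 j).1) ((p.1 i).2 - (p.1 j).2)) p.1 :=
    hGm.measurable_freeFlight₂.comp (hτ.prodMk measurable_fst)
  have hL : Measurable fun p : Config N (Fin 3) (UnitAddTorus (Fin 3)) × EuclideanSpace ℝ (Fin 3) =>
      lambertPair (Torus.geometry (Fin 3)) i j (freeFlight (Torus.geometry (Fin 3))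
        (pairHitTime ε ((Torus.geometry (Fin 3)).sepVec (p.1 i).1 (p.1 j).1) ((p.1 i).2 - (p.1 j).2)) p.1) p.2 :=
    (measurable_lambertPair hGm i j).comp (hS.prodMk measurable_snd)
  exact hGm.measurable_freeFlight₂.comp (hτ.neg.prodMk ((hGm.measurable_collidePair i j).comp hL))

omit [Fintype d] in
/-- Relative pair data of a sheared-back configuration: `(shearAt i (z ↦ z_j) z) i − (…) j = z i`. [folklore] -/
theorem shearAt_back_sub (hij : i ≠ j) (z : Config N d (UnitAddTorus d)) :
    shearAt i (fun z => z j) z i - shearAt i (fun z => z j) z j = z i := by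
  rw [shearAt_apply_self, shearAt_apply_of_ne hij.symm, add_sub_cancel_right]

/-- **The Lambertian pre-kick preserves `vol ⊗ γ` on the good pair data** (`𝕋³`, `N` particles, pair
`i ≠ j`): on `M₀ = {z | (x_i − x_j, v_i − v_j) lifts into billiardGood ε, τ₀ ≤ δ, ‖v_i − v_j‖ ≤ R}`
(`ε + 2δR < 1/2`), for measurable `F ≥ 0`, `∫_{M₀} ∫ F(J_ξ z) dγ(ξ) dz = ∫_{M₀} F`. Relative coordinates
(`shearAt_lambertKick`), the lift `lintegral_lift_redraw` and the chart redraw `lintegral_phase_redraw`.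
[folklore] -/
theorem lintegral_lambertKick {δ R : ℝ} (hε : 0 < ε) (hδ : 0 ≤ δ) (hR : 0 ≤ R) (hch : ε + 2 * (δ * R) < 1 / 2)
    (hij : i ≠ j) {F : Config N (Fin 3) (UnitAddTorus (Fin 3)) → ℝ≥0∞} (hF : Measurable F) :
    ∫⁻ z in {z : Config N (Fin 3) (UnitAddTorus (Fin 3)) |
        (((Torus.geometry (Fin 3)).sepVec (z i).1 (z j).1, (z i).2 - (z j).2) :
            EuclideanSpace ℝ (Fin 3) × EuclideanSpace ℝ (Fin 3)) ∈ billiardGood ε ∧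
          pairHitTime ε ((Torus.geometry (Fin 3)).sepVec (z i).1 (z j).1) ((z i).2 - (z j).2) ≤ δ ∧
          ‖(z i).2 - (z j).2‖ ≤ R},
      (∫⁻ ξ, F (freeFlight (Torus.geometry (Fin 3))
        (-pairHitTime ε ((Torus.geometry (Fin 3)).sepVec (z i).1 (z j).1) ((z i).2 - (z j).2))
        (collidePair (Torus.geometry (Fin 3)) i j (lambertPair (Torus.geometry (Fin 3)) i j
          (freeFlight (Torus.geometry (Fin 3))
            (pairHitTime ε ((Torus.geometry (Fin 3)).sepVec (z i).1 (z j).1) ((z i).2 - (z j).2)) z) ξ)))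
        ∂(stdGaussian (EuclideanSpace ℝ (Fin 3)))) =
    ∫⁻ z in {z : Config N (Fin 3) (UnitAddTorus (Fin 3)) |
        (((Torus.geometry (Fin 3)).sepVec (z i).1 (z j).1, (z i).2 - (z j).2) :
            EuclideanSpace ℝ (Fin 3) × EuclideanSpace ℝ (Fin 3)) ∈ billiardGood ε ∧
          pairHitTime ε ((Torus.geometry (Fin 3)).sepVec (z i).1 (z j).1) ((z i).2 - (z j).2) ≤ δ ∧
          ‖(z i).2 - (z j).2‖ ≤ R}, F z := by
  -- abbreviations, made opaque
  obtain ⟨J, hJ⟩ : ∃ J : EuclideanSpace ℝ (Fin 3) → Config N (Fin 3) (UnitAddTorus (Fin 3)) →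
      Config N (Fin 3) (UnitAddTorus (Fin 3)), J = fun ξ z => freeFlight (Torus.geometry (Fin 3))
        (-pairHitTime ε ((Torus.geometry (Fin 3)).sepVec (z i).1 (z j).1) ((z i).2 - (z j).2))
        (collidePair (Torus.geometry (Fin 3)) i j (lambertPair (Torus.geometry (Fin 3)) i j
          (freeFlight (Torus.geometry (Fin 3))
            (pairHitTime ε ((Torus.geometry (Fin 3)).sepVec (z i).1 (z j).1) ((z i).2 - (z j).2)) z) ξ)) := ⟨_, rfl⟩
  obtain ⟨T, hT⟩ : ∃ T : EuclideanSpace ℝ (Fin 3) → UnitAddTorus (Fin 3) × EuclideanSpace ℝ (Fin 3) →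
      UnitAddTorus (Fin 3) × EuclideanSpace ℝ (Fin 3), T = fun ξ a => projPhase
        (hitPoint ε (liftPhase a) - pairHitTime ε (liftPhase a).1 (liftPhase a).2 •
          (‖(liftPhase a).2‖ • (lambertDir (hitPoint ε (liftPhase a)) ξ - (2 * ⟪lambertDir (hitPoint ε (liftPhase a)) ξ, hitPoint ε (liftPhase a)⟫_ℝ / ‖hitPoint ε (liftPhase a)‖ ^ 2) • hitPoint ε (liftPhase a))),
         ‖(liftPhase a).2‖ • (lambertDir (hitPoint ε (liftPhase a)) ξ - (2 * ⟪lambertDir (hitPoint ε (liftPhase a)) ξ, hitPoint ε (liftPhase a)⟫_ℝ / ‖hitPoint ε (liftPhase a)‖ ^ 2) • hitPoint ε (liftPhase a))) :=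
    ⟨_, rfl⟩
  obtain ⟨cc, hcc⟩ : ∃ cc : EuclideanSpace ℝ (Fin 3) → UnitAddTorus (Fin 3) × EuclideanSpace ℝ (Fin 3) →
      UnitAddTorus (Fin 3) × EuclideanSpace ℝ (Fin 3), cc = fun ξ a =>
        (Literature.Analysis.FunctionSpaces.Torus.proj (-(pairHitTime ε (liftPhase a).1 (liftPhase a).2 •
          ((2 : ℝ)⁻¹ • ((liftPhase a).2 - ‖(liftPhase a).2‖ •
            (lambertDir (hitPoint ε (liftPhase a)) ξ - (2 * ⟪lambertDir (hitPoint ε (liftPhase a)) ξ, hitPoint ε (liftPhase a)⟫_ℝ / ‖hitPoint ε (liftPhase a)‖ ^ 2) • hitPoint ε (liftPhase a)))))),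
         (2 : ℝ)⁻¹ • ((liftPhase a).2 - ‖(liftPhase a).2‖ •
            (lambertDir (hitPoint ε (liftPhase a)) ξ - (2 * ⟪lambertDir (hitPoint ε (liftPhase a)) ξ, hitPoint ε (liftPhase a)⟫_ℝ / ‖hitPoint ε (liftPhase a)‖ ^ 2) • hitPoint ε (liftPhase a)))) := ⟨_, rfl⟩
  set D₀ : Set (UnitAddTorus (Fin 3) × EuclideanSpace ℝ (Fin 3)) :=
    {a | liftPhase a ∈ (billiardGood ε : Set (EuclideanSpace ℝ (Fin 3) × EuclideanSpace ℝ (Fin 3))) ∧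
      pairHitTime ε (liftPhase a).1 (liftPhase a).2 ≤ δ ∧ ‖a.2‖ ≤ R} with hD₀
  have hD₀m : MeasurableSet D₀ :=
    (measurable_liftPhase (measurableSet_billiardGood ε)).inter
      ((measurableSet_le ((measurable_pairHitTime ε).comp measurable_liftPhase) measurable_const).inter
        (measurableSet_le measurable_snd.norm measurable_const))
  set M₀ : Set (Config N (Fin 3) (UnitAddTorus (Fin 3))) := {z |
      (((Torus.geometry (Fin 3)).sepVec (z i).1 (z j).1, (z i).2 - (z j).2) :
          EuclideanSpace ℝ (Fin 3) × EuclideanSpace ℝ (Fin 3)) ∈ billiardGood ε ∧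
        pairHitTime ε ((Torus.geometry (Fin 3)).sepVec (z i).1 (z j).1) ((z i).2 - (z j).2) ≤ δ ∧
        ‖(z i).2 - (z j).2‖ ≤ R} with hM₀
  have hlift : ∀ z : Config N (Fin 3) (UnitAddTorus (Fin 3)),
      liftPhase (z i - z j) = ((Torus.geometry (Fin 3)).sepVec (z i).1 (z j).1, (z i).2 - (z j).2) := fun z => rfl
  have hM₀D : ∀ z : Config N (Fin 3) (UnitAddTorus (Fin 3)), z ∈ M₀ ↔ z i - z j ∈ D₀ := by
    intro z
    rw [hM₀, hD₀, mem_setOf_eq, mem_setOf_eq, hlift]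
    exact ⟨fun ⟨h1, h2, h3⟩ => ⟨h1, h2, h3⟩, fun ⟨h1, h2, h3⟩ => ⟨h1, h2, h3⟩⟩
  have hM₀m : MeasurableSet M₀ := by
    have : M₀ = (fun z : Config N (Fin 3) (UnitAddTorus (Fin 3)) => z i - z j) ⁻¹' D₀ := by
      ext z; exact hM₀D z
    rw [this]
    exact ((measurable_pi_apply i).sub (measurable_pi_apply j)) hD₀m
  -- the shears
  have hφ : Measurable fun z : Config N (Fin 3) (UnitAddTorus (Fin 3)) => z j := measurable_pi_apply j
  have hφi : ∀ (z : Config N (Fin 3) (UnitAddTorus (Fin 3))) (a : UnitAddTorus (Fin 3) × EuclideanSpace ℝ (Fin 3)),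
      (fun z : Config N (Fin 3) (UnitAddTorus (Fin 3)) => z j) (update z i a) = (fun z => z j) z :=
    fun z a => update_of_ne hij.symm a z
  have hback : ∀ z : Config N (Fin 3) (UnitAddTorus (Fin 3)),
      shearAt i (fun z => -z j) (shearAt i (fun z => z j) z) = z := by
    intro z
    have h := shearAt_neg_shearAt (φ := fun z : Config N (Fin 3) (UnitAddTorus (Fin 3)) => z j) (i := i) hφi z
    exact h
  have hforth : ∀ z : Config N (Fin 3) (UnitAddTorus (Fin 3)),
      shearAt i (fun z => z j) (shearAt i (fun z => -z j) z) = z := by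
    intro z
    have h := shearAt_shearAt_neg (φ := fun z : Config N (Fin 3) (UnitAddTorus (Fin 3)) => z j) (i := i) hφi z
    exact h
  -- chart condition on `M₀`
  have hchart : ∀ z ∈ M₀, ‖(Torus.geometry (Fin 3)).sepVec (z i).1 (z j).1‖ +
      |pairHitTime ε ((Torus.geometry (Fin 3)).sepVec (z i).1 (z j).1) ((z i).2 - (z j).2)| *
        ‖(z i).2 - (z j).2‖ < 1 / 2 := by
    rintro z ⟨hz, hτ, hw⟩
    set u : EuclideanSpace ℝ (Fin 3) × EuclideanSpace ℝ (Fin 3) :=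
      ((Torus.geometry (Fin 3)).sepVec (z i).1 (z j).1, (z i).2 - (z j).2) with hu
    have hτ0 : 0 < pairHitTime ε u.1 u.2 := pairHitTime_pos hε.le hz.1 (PairHits.of_mem_billiardGood hz)
    have hq : ‖u.1‖ ≤ ε + δ * R := by
      have h1 : u.1 = hitPoint ε u - pairHitTime ε u.1 u.2 • u.2 := by simp [hitPoint]
      calc ‖u.1‖ = ‖hitPoint ε u - pairHitTime ε u.1 u.2 • u.2‖ := by rw [← h1]
        _ ≤ ‖hitPoint ε u‖ + ‖pairHitTime ε u.1 u.2 • u.2‖ := norm_sub_le _ _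
        _ ≤ ε + δ * R := by
            rw [norm_hitPoint hε.le hz, norm_smul, Real.norm_of_nonneg hτ0.le]
            linarith [mul_le_mul hτ hw (norm_nonneg u.2) hδ]
    have h2 : |pairHitTime ε u.1 u.2| * ‖u.2‖ ≤ δ * R := by
      rw [abs_of_pos hτ0]; exact mul_le_mul hτ hw (norm_nonneg _) hδ
    change ‖u.1‖ + |pairHitTime ε u.1 u.2| * ‖u.2‖ < 1 / 2
    linarith
  -- the conjugation on `M₀`
  have hconj : ∀ z ∈ M₀, ∀ ξ : EuclideanSpace ℝ (Fin 3), J ξ z = shearAt i (fun z => z j)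
      (update (update (shearAt i (fun z => -z j) z) i (T ξ (shearAt i (fun z => -z j) z i))) j
        (shearAt i (fun z => -z j) z j + cc ξ (shearAt i (fun z => -z j) z i))) := by
    intro z hz ξ
    have h := shearAt_lambertKick (ε := ε) hij z ξ (hchart z hz)
    rw [hJ, hT, hcc]
    rw [← h, hforth]
  -- measurability
  have hJm : Measurable fun p : Config N (Fin 3) (UnitAddTorus (Fin 3)) × EuclideanSpace ℝ (Fin 3) => J p.2 p.1 := by
    rw [hJ]; beta_reduce; exact measurable_lambertKick ε i j
  have hTm : Measurable fun p : EuclideanSpace ℝ (Fin 3) × (UnitAddTorus (Fin 3) × EuclideanSpace ℝ (Fin 3)) => T p.1 p.2 := by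
    rw [hT]
    beta_reduce
    have h1 : Measurable fun p : EuclideanSpace ℝ (Fin 3) × (UnitAddTorus (Fin 3) × EuclideanSpace ℝ (Fin 3)) =>
        ((liftPhase p.2, p.1) : (EuclideanSpace ℝ (Fin 3) × EuclideanSpace ℝ (Fin 3)) × EuclideanSpace ℝ (Fin 3)) :=
      (measurable_liftPhase.comp measurable_snd).prodMk measurable_fst
    have h2 := (measurable_redrawRel ε).comp h1
    exact measurable_projPhase.comp h2
  have hccm : Measurable fun p : EuclideanSpace ℝ (Fin 3) × (UnitAddTorus (Fin 3) × EuclideanSpace ℝ (Fin 3)) => cc p.1 p.2 := by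
    rw [hcc]
    beta_reduce
    have h1 : Measurable fun p : EuclideanSpace ℝ (Fin 3) × (UnitAddTorus (Fin 3) × EuclideanSpace ℝ (Fin 3)) =>
        ((liftPhase p.2, p.1) : (EuclideanSpace ℝ (Fin 3) × EuclideanSpace ℝ (Fin 3)) × EuclideanSpace ℝ (Fin 3)) :=
      (measurable_liftPhase.comp measurable_snd).prodMk measurable_fst
    have hb : Measurable fun p : EuclideanSpace ℝ (Fin 3) × (UnitAddTorus (Fin 3) × EuclideanSpace ℝ (Fin 3)) =>
        (2 : ℝ)⁻¹ • ((liftPhase p.2).2 - ‖(liftPhase p.2).2‖ •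
          (lambertDir (hitPoint ε (liftPhase p.2)) p.1 - (2 * ⟪lambertDir (hitPoint ε (liftPhase p.2)) p.1, hitPoint ε (liftPhase p.2)⟫_ℝ / ‖hitPoint ε (liftPhase p.2)‖ ^ 2) • hitPoint ε (liftPhase p.2))) :=
      (measurable_halfImpulse ε).comp h1
    have hτ : Measurable fun p : EuclideanSpace ℝ (Fin 3) × (UnitAddTorus (Fin 3) × EuclideanSpace ℝ (Fin 3)) =>
        pairHitTime ε (liftPhase p.2).1 (liftPhase p.2).2 :=
      (measurable_pairHitTime ε).comp (measurable_liftPhase.comp measurable_snd)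
    exact (Literature.Analysis.FunctionSpaces.Torus.measurable_proj.comp (hτ.smul hb).neg).prodMk hb
  have hKm : Measurable fun z : Config N (Fin 3) (UnitAddTorus (Fin 3)) =>
      ∫⁻ ξ, F (J ξ z) ∂(stdGaussian (EuclideanSpace ℝ (Fin 3))) := (hF.comp hJm).lintegral_prod_right'
  -- the statement in terms of `J`
  have hstmt : (fun z : Config N (Fin 3) (UnitAddTorus (Fin 3)) => ∫⁻ ξ, F (freeFlight (Torus.geometry (Fin 3))
      (-pairHitTime ε ((Torus.geometry (Fin 3)).sepVec (z i).1 (z j).1) ((z i).2 - (z j).2))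
      (collidePair (Torus.geometry (Fin 3)) i j (lambertPair (Torus.geometry (Fin 3)) i j
        (freeFlight (Torus.geometry (Fin 3))
          (pairHitTime ε ((Torus.geometry (Fin 3)).sepVec (z i).1 (z j).1) ((z i).2 - (z j).2)) z) ξ)))
      ∂(stdGaussian (EuclideanSpace ℝ (Fin 3)))) = fun z => ∫⁻ ξ, F (J ξ z) ∂(stdGaussian (EuclideanSpace ℝ (Fin 3))) := by
    rw [hJ]
  rw [hstmt]
  -- pass to relative coordinates
  have hL := lintegral_comp_shearAt (i := i) hφ hφi ((hKm).indicator hM₀m)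
  have hR' := lintegral_comp_shearAt (i := i) hφ hφi (hF.indicator hM₀m)
  rw [← lintegral_indicator hM₀m, ← lintegral_indicator hM₀m, ← hL, ← hR']
  have hmemb : ∀ z : Config N (Fin 3) (UnitAddTorus (Fin 3)), shearAt i (fun z => z j) z ∈ M₀ ↔
      z ∈ {z : Config N (Fin 3) (UnitAddTorus (Fin 3)) | z i ∈ D₀} := by
    intro z
    rw [hM₀D, shearAt_back_sub hij]
    exact Iff.rfl
  have hDm : MeasurableSet {z : Config N (Fin 3) (UnitAddTorus (Fin 3)) | z i ∈ D₀} := (measurable_pi_apply i) hD₀m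
  have e1 : (fun z => M₀.indicator (fun z => ∫⁻ ξ, F (J ξ z) ∂(stdGaussian (EuclideanSpace ℝ (Fin 3))))
      (shearAt i (fun z => z j) z)) = {z : Config N (Fin 3) (UnitAddTorus (Fin 3)) | z i ∈ D₀}.indicator
        (fun z => ∫⁻ ξ, F (shearAt i (fun z => z j) (update (update z i (T ξ (z i))) j (z j + cc ξ (z i))))
          ∂(stdGaussian (EuclideanSpace ℝ (Fin 3)))) := by
    funext z
    by_cases hz : shearAt i (fun z => z j) z ∈ M₀
    · rw [indicator_of_mem hz, indicator_of_mem ((hmemb z).1 hz)]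
      refine lintegral_congr fun ξ => ?_
      rw [hconj _ hz ξ, hback]
    · rw [indicator_of_notMem hz, indicator_of_notMem (fun h => hz ((hmemb z).2 h))]
  have e2 : (fun z => M₀.indicator F (shearAt i (fun z => z j) z)) =
      {z : Config N (Fin 3) (UnitAddTorus (Fin 3)) | z i ∈ D₀}.indicator (fun z => F (shearAt i (fun z => z j) z)) := by
    funext z
    by_cases hz : shearAt i (fun z => z j) z ∈ M₀
    · rw [indicator_of_mem hz, indicator_of_mem ((hmemb z).1 hz)]
    · rw [indicator_of_notMem hz, indicator_of_notMem (fun h => hz ((hmemb z).2 h))]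
  rw [e1, e2, lintegral_indicator hDm, lintegral_indicator hDm]
  -- the lift
  have hF' : Measurable fun z : Config N (Fin 3) (UnitAddTorus (Fin 3)) => F (shearAt i (fun z => z j) z) :=
    hF.comp (measurable_shearAt hφ)
  refine lintegral_lift_redraw (stdGaussian (EuclideanSpace ℝ (Fin 3))) hij hTm hccm hD₀m ?_ hF'
  intro g hg
  have h := lintegral_phase_redraw (R := R) hε hδ (by nlinarith) hg
  rw [hT]
  exact h

end JMap








end HalfAngle

end Summit.AtomisticToContinuum.HydrodynamicLimit.Theorems
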